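import Literature.MathematicalPhysics.QuantumLattice.TubeBoostReflection
import Literature.MathematicalPhysics.QuantumLattice.WightmanAnalyticContinuation
import HarnessLib

/-!
# Complex boosts of boost-covariant holomorphic functions on the `n`-point relative forward tube

Topic `Literature/MathematicalPhysics/QuantumLattice` (trunk T-AQFT). The `n`-variable version of
`TubeBoostReflection`: the elementary, one-parameter substitute for the Bargmann–Hall–Wightman
continuation (Streater–Wightman (1964), §2-4, Thm. 2-11) along the boosts in the `(0, 3)`-plane,
now for functions of `n` complex four-vectors `z = (z₀, …, z_{n−1})` holomorphic on the **relative
forward tube** `𝒯ʳₙ = {Im (z_k − z_{k−1}) ∈ V₊, 1 ≤ k < n}` (`QuantumFieldTheory.relForwardTube 3 n`,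
the tube of the vacuum expectation values in absolute variables, with no condition on `Im z₀`), as
needed in the proof of the PCT theorem (§4-3, Thm. 4-7: "`𝒲` is invariant under the complex
Lorentz transformation `−1 = B(iπ) R`").

The boost `B(w)` acts on every variable (`boostN w z k = boost w (z k)`); it commutes with the
successive differences, so `z ∈ 𝒯ʳₙ ↔` every difference lies in the one-point tube `T⁺`, and all
statements reduce difference-by-difference to `TubeBoostReflection`:

* `boostDomainN z₀ = ⋂_k boostDomain (z_k − z_{k−1})` is an open convex set of complex rapidities
  containing `0`, invariant under real translations, on which `B(w) z₀ ∈ 𝒯ʳₙ`;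
* `boost_covariance_complexN` (**complex boost covariance inside `𝒯ʳₙ`**): if `F` is holomorphic
  on `𝒯ʳₙ` (values in a complex Banach space) and `F(B(χ)z) = M(χ) F(z)` for real `χ` with `M` an
  entire one-parameter group, then `F(B(w)z₀) = M(w) F(z₀)` for `w ∈ boostDomainN z₀`;
* `wedgeDomainN`, `wedgeExtensionN M F = M(−iπ/2) F(B(iπ/2) ·)` (**continuation across the right
  wedge configurations**): holomorphic on the open set `wedgeDomainN ⊇ {x real | x_k − x_{k−1} ∈ W_R}`
  (`W_R = {ξ³ > |ξ⁰|}`, `complexifyConfig_mem_wedgeDomainN`), equal to `F` on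
  `wedgeDomainN ∩ 𝒯ʳₙ`, and the limit of `F` from within `𝒯ʳₙ` at every point of `wedgeDomainN`;
* the left wedge: `wedgeExtensionNegN M F = M(iπ/2) F(B(−iπ/2) ·)` on `wedgeDomainNegN ⊇
  {x real | x_k − x_{k−1} ∈ W_L}`, and the **reflection identity**
  `wedgeExtensionNegN M F (B(iπ) y) = M(iπ) (wedgeExtensionN M F y)` (`B(iπ)` is the real map
  `r : (x⁰, x¹, x², x³) ↦ (−x⁰, x¹, x², −x³)`, `boost_pi_mul_I_apply`), which is the
  function-theoretic content of "`𝒲(r ξ) = S(B(iπ)) 𝒲(ξ)`" at Jost points of the wedge;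
* the rotation `R` by `π` about the third axis acting on all variables (`rot3N`) preserves all these
  sets and passes through the extensions (`wedgeExtensionN_rot3N`).

## References

* R. F. Streater, A. S. Wightman, *PCT, Spin and Statistics, and All That* (1964; Princeton 2000),
  §2-4 Thms. 2-11, 2-12 and eq. (2-91); §4-3 Thm. 4-7, eqs. (4-29)–(4-35). [StreaterWightman1964]
-/

noncomputable section

open Complex Set Filter
open _root_.Topology
open scoped Real

namespace Literature.MathematicalPhysics.QuantumLattice

namespace TubeBoost

variable {n : ℕ}

/-! ### The boost acting on configurations -/

/-- `B(w)` is additive: `B(w)(ζ − ζ') = B(w)ζ − B(w)ζ'`. [folklore] -/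
theorem boost_sub (w : ℂ) (ζ ζ' : Fin (3 + 1) → ℂ) : boost w (ζ - ζ') = boost w ζ - boost w ζ' := by
  funext μ
  simp only [boost, lcU, lcV, Pi.sub_apply]
  split_ifs <;> ring

/-- `B(w)(−ζ) = −B(w)ζ`. [folklore] -/
theorem boost_neg (w : ℂ) (ζ : Fin (3 + 1) → ℂ) : boost w (-ζ) = -boost w ζ := by
  have h := boost_sub w 0 ζ
  have h0 : boost w 0 = 0 := by
    have := boost_sub w ζ ζ
    rwa [sub_self, sub_self] at this
  rwa [zero_sub, h0, zero_sub] at h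

/-- The **boost of complex rapidity `w` acting on an `n`-point configuration**, variable by
variable. [cite: StreaterWightman1964, §2-4 eq. (2-91)] -/
def boostN (w : ℂ) (z : Fin n → Fin (3 + 1) → ℂ) : Fin n → Fin (3 + 1) → ℂ := fun k => boost w (z k)

/-- `boostN_apply`: component formula. [folklore] -/
@[simp] theorem boostN_apply (w : ℂ) (z : Fin n → Fin (3 + 1) → ℂ) (k : Fin n) :
    boostN w z k = boost w (z k) := rfl

/-- `B(0) = id`. [folklore] -/
@[simp] theorem boostN_zero (z : Fin n → Fin (3 + 1) → ℂ) : boostN 0 z = z := by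
  funext k; simp

/-- Group law. [folklore] -/
theorem boostN_add (w w' : ℂ) (z : Fin n → Fin (3 + 1) → ℂ) : boostN (w + w') z = boostN w (boostN w' z) := by
  funext k; simp [boost_add]

/-- `B(−w) B(w) = id`. [folklore] -/
@[simp] theorem boostN_neg_boostN (w : ℂ) (z : Fin n → Fin (3 + 1) → ℂ) : boostN (-w) (boostN w z) = z := by
  rw [← boostN_add, neg_add_cancel, boostN_zero]

/-- **The boost commutes with the successive differences.** [folklore] -/
theorem succDiff_boostN (w : ℂ) (z : Fin n → Fin (3 + 1) → ℂ) (k : Fin n) :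
    succDiff (boostN w z) k = boost w (succDiff z k) :=
  succDiff_map (boost w) (boost_sub w) z k

/-- `w ↦ B(w) z` is entire. [folklore] -/
theorem differentiable_boostN_left (z : Fin n → Fin (3 + 1) → ℂ) : Differentiable ℂ fun w => boostN w z :=
  differentiable_pi.2 fun k => differentiable_boost_left (z k)

/-- `z ↦ B(w) z` is complex linear, in particular differentiable. [folklore] -/
theorem differentiable_boostN_right (w : ℂ) : Differentiable ℂ (boostN (n := n) w) :=
  differentiable_pi.2 fun k => (differentiable_boost_right w).comp (differentiable_apply k)

/-- `z ↦ B(w) z` is continuous. [folklore] -/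
theorem continuous_boostN_right (w : ℂ) : Continuous (boostN (n := n) w) :=
  (differentiable_boostN_right w).continuous

/-! ### The relative forward tube in light-cone terms -/

/-- `z ∈ 𝒯ʳₙ ↔` every successive difference `z_k − z_{k−1}`, `k ≥ 1`, lies in the one-point tube
`T⁺` (definitional unfolding of `QuantumFieldTheory.relForwardTube` for `d = 3`). [folklore] -/
theorem mem_relForwardTube_iff_succDiff (z : Fin n → Fin (3 + 1) → ℂ) :
    z ∈ QuantumFieldTheory.relForwardTube 3 n ↔ ∀ k : Fin n, 0 < (k : ℕ) → succDiff z k ∈ upperTube :=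
  Iff.rfl

/-- **Real boosts preserve `𝒯ʳₙ`.** [cite: StreaterWightman1964, §2-4] -/
theorem boostN_ofReal_mem_relForwardTube_iff (z : Fin n → Fin (3 + 1) → ℂ) (χ : ℝ) :
    boostN χ z ∈ QuantumFieldTheory.relForwardTube 3 n ↔ z ∈ QuantumFieldTheory.relForwardTube 3 n := by
  simp only [mem_relForwardTube_iff_succDiff, succDiff_boostN, boost_ofReal_mem_upperTube_iff]

/-! ### The domain of complex rapidities -/

/-- The **domain of complex rapidities** at `z₀ ∈ 𝒯ʳₙ`: the rapidities admissible for every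
difference, `⋂_{k ≥ 1} boostDomain (z_k − z_{k−1})`. [folklore] -/
def boostDomainN (z₀ : Fin n → Fin (3 + 1) → ℂ) : Set ℂ :=
  {w | ∀ k : Fin n, 0 < (k : ℕ) → w ∈ boostDomain (succDiff z₀ k)}

/-- On the domain the boosted configuration lies in `𝒯ʳₙ`. [folklore] -/
theorem boostN_mem_relForwardTube_of_mem_boostDomainN {z₀ : Fin n → Fin (3 + 1) → ℂ} {w : ℂ}
    (hw : w ∈ boostDomainN z₀) : boostN w z₀ ∈ QuantumFieldTheory.relForwardTube 3 n := by
  rw [mem_relForwardTube_iff_succDiff]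
  intro k hk
  rw [succDiff_boostN]
  exact (hw k hk).1

/-- `0` is in the domain. [folklore] -/
theorem zero_mem_boostDomainN {z₀ : Fin n → Fin (3 + 1) → ℂ} (hz₀ : z₀ ∈ QuantumFieldTheory.relForwardTube 3 n) :
    (0 : ℂ) ∈ boostDomainN z₀ := fun k hk => zero_mem_boostDomain (hz₀ k hk)

/-- The domain is invariant under real translations of the rapidity. [folklore] -/
theorem add_ofReal_mem_boostDomainN {z₀ : Fin n → Fin (3 + 1) → ℂ} {w : ℂ} (hw : w ∈ boostDomainN z₀) (χ : ℝ) :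
    w + χ ∈ boostDomainN z₀ := fun k hk => add_ofReal_mem_boostDomain (hw k hk) χ

/-- The domain is open. [folklore] -/
theorem isOpen_boostDomainN (z₀ : Fin n → Fin (3 + 1) → ℂ) : IsOpen (boostDomainN z₀) := by
  have h : boostDomainN z₀ = ⋂ k : Fin n, {w : ℂ | 0 < (k : ℕ) → w ∈ boostDomain (succDiff z₀ k)} := by
    ext w; simp [boostDomainN]
  rw [h]
  refine isOpen_iInter_of_finite fun k => ?_
  by_cases hk : 0 < (k : ℕ)
  · simp only [hk, forall_true_left, setOf_mem_eq]
    exact isOpen_boostDomain _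
  · simp only [hk, IsEmpty.forall_iff, setOf_true, isOpen_univ]

/-- **The domain is convex** (an intersection of the strips `boostDomain`). [folklore] -/
theorem convex_boostDomainN {z₀ : Fin n → Fin (3 + 1) → ℂ} (hz₀ : z₀ ∈ QuantumFieldTheory.relForwardTube 3 n) :
    Convex ℝ (boostDomainN z₀) := by
  have h : boostDomainN z₀ = ⋂ k : Fin n, {w : ℂ | 0 < (k : ℕ) → w ∈ boostDomain (succDiff z₀ k)} := by
    ext w; simp [boostDomainN]
  rw [h]
  refine convex_iInter fun k => ?_
  by_cases hk : 0 < (k : ℕ)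
  · simp only [hk, forall_true_left, setOf_mem_eq]
    exact convex_boostDomain (hz₀ k hk)
  · simp only [hk, IsEmpty.forall_iff, setOf_true]
    exact convex_univ

/-! ### Complex boost covariance inside the relative tube -/

section Covariance

variable {E : Type*} [NormedAddCommGroup E] [NormedSpace ℂ E]

/-- **Complex boost covariance inside `𝒯ʳₙ`** (Streater–Wightman (1964), Thm. 2-11 for the boosts,
`n` variables): let `F` be holomorphic on `𝒯ʳₙ` and covariant under the real boosts,
`F(B(χ)z) = M(χ) F(z)`, for an entire one-parameter group `M`. Then `F(B(w)z₀) = M(w) F(z₀)` for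
every `z₀ ∈ 𝒯ʳₙ` and every `w ∈ boostDomainN z₀`. Proof as in one variable: `w ↦ M(−w) F(B(w)z₀)`
is holomorphic on the convex domain and invariant under real translations, hence constant.
[cite: StreaterWightman1964, §2-4 Thm 2-11; §4-3 eq. (4-29)] -/
theorem boost_covariance_complexN {F : (Fin n → Fin (3 + 1) → ℂ) → E}
    (hF : DifferentiableOn ℂ F (QuantumFieldTheory.relForwardTube 3 n))
    {M : ℂ → E →L[ℂ] E} (hM : Differentiable ℂ M) (hM0 : M 0 = 1)
    (hMadd : ∀ a b, M (a + b) = M a * M b)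
    (hcov : ∀ (χ : ℝ), ∀ z ∈ QuantumFieldTheory.relForwardTube 3 n, F (boostN χ z) = M χ (F z))
    {z₀ : Fin n → Fin (3 + 1) → ℂ} (hz₀ : z₀ ∈ QuantumFieldTheory.relForwardTube 3 n) {w : ℂ}
    (hw : w ∈ boostDomainN z₀) : F (boostN w z₀) = M w (F z₀) := by
  set φ : ℂ → E := fun z => M (-z) (F (boostN z z₀)) with hφdef
  have hdiff : ∀ z ∈ boostDomainN z₀, DifferentiableAt ℂ φ z := by
    intro z hz
    have h1 : DifferentiableAt ℂ (fun z => M (-z)) z := (hM.comp differentiable_neg).differentiableAt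
    have h2 : DifferentiableAt ℂ (fun z => F (boostN z z₀)) z :=
      (hF.differentiableAt (isOpen_relForwardTube.mem_nhds (boostN_mem_relForwardTube_of_mem_boostDomainN hz))).comp z
        (differentiable_boostN_left z₀).differentiableAt
    exact h1.clm_apply h2
  have hper : ∀ z ∈ boostDomainN z₀, ∀ χ : ℝ, φ (z + χ) = φ z := by
    intro z hz χ
    simp only [hφdef]
    rw [show z + (χ : ℂ) = (χ : ℂ) + z from add_comm _ _, boostN_add,
      hcov χ _ (boostN_mem_relForwardTube_of_mem_boostDomainN hz),
      show M (-((χ : ℂ) + z)) (M χ (F (boostN z z₀))) = (M (-((χ : ℂ) + z)) * M χ) (F (boostN z z₀))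
        from rfl, ← hMadd]
    congr 2; ring
  have hderiv : ∀ z ∈ boostDomainN z₀, HasDerivWithinAt φ ((fun _ => (0 : E)) z) (boostDomainN z₀) z := by
    intro z hz
    have h := (hdiff z hz).hasDerivAt
    have h0 : deriv φ z = 0 := hasDerivAt_zero_of_real_periodic h (hper z hz)
    rw [h0] at h
    exact h.hasDerivWithinAt
  have hconst := (convex_boostDomainN hz₀).norm_image_sub_le_of_norm_hasDerivWithin_le (C := 0) hderiv
    (fun _ _ => by simp) (zero_mem_boostDomainN hz₀) hw
  rw [zero_mul, norm_le_zero_iff, sub_eq_zero] at hconst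
  simp only [hφdef, neg_zero, hM0, boostN_zero, ContinuousLinearMap.one_def,
    ContinuousLinearMap.id_apply] at hconst
  have hinv : M w * M (-w) = 1 := by rw [← hMadd, add_neg_cancel, hM0]
  calc F (boostN w z₀) = (M w * M (-w)) (F (boostN w z₀)) := by rw [hinv]; rfl
    _ = M w (M (-w) (F (boostN w z₀))) := rfl
    _ = M w (F z₀) := by rw [hconst]

end Covariance

/-! ### Continuation across the right wedge configurations -/

section Wedge

variable {E : Type*} [NormedAddCommGroup E] [NormedSpace ℂ E]

/-- The **right-wedge domain** of configurations: every difference `z_k − z_{k−1}` (`k ≥ 1`) lies in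
the one-point wedge domain (its quarter-turn boost lies in `T⁺`, `Re u > 0 > Re v`). An open
neighbourhood of the real configurations with differences in the right wedge `{ξ³ > |ξ⁰|}`.
[folklore] -/
def wedgeDomainN : Set (Fin n → Fin (3 + 1) → ℂ) :=
  {z | ∀ k : Fin n, 0 < (k : ℕ) → succDiff z k ∈ wedgeDomain}

/-- The quarter-turn boost of a point of the wedge domain lies in `𝒯ʳₙ`. [folklore] -/
theorem boostN_mem_relForwardTube_of_mem_wedgeDomainN {z : Fin n → Fin (3 + 1) → ℂ} (hz : z ∈ wedgeDomainN) :
    boostN (π / 2 * I) z ∈ QuantumFieldTheory.relForwardTube 3 n := by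
  rw [mem_relForwardTube_iff_succDiff]
  intro k hk
  rw [succDiff_boostN]
  exact (hz k hk).1

/-- The wedge domain is open. [folklore] -/
theorem isOpen_wedgeDomainN : IsOpen (wedgeDomainN (n := n)) := by
  have h : wedgeDomainN (n := n) = ⋂ k : Fin n, {z | 0 < (k : ℕ) → succDiff z k ∈ wedgeDomain} := by
    ext z; simp [wedgeDomainN]
  rw [h]
  refine isOpen_iInter_of_finite fun k => ?_
  by_cases hk : 0 < (k : ℕ)
  · simp only [hk, forall_true_left]
    have hc : Continuous fun z : Fin n → Fin (3 + 1) → ℂ => succDiff z k :=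
      (continuous_apply k).sub ((continuous_apply _).comp
        (continuous_pi fun j => by
          refine Fin.cases ?_ (fun i => ?_) j
          · simpa using continuous_const
          · simpa using continuous_apply i))
    exact isOpen_wedgeDomain.preimage hc
  · simp only [hk, IsEmpty.forall_iff, setOf_true, isOpen_univ]

/-- The complexification of a real configuration. [folklore] -/
def complexifyConfig (x : Fin n → SpaceTime 3) : Fin n → Fin (3 + 1) → ℂ := fun k => complexifyPoint (x k)

/-- `complexifyConfig_apply`: component formula. [folklore] -/
@[simp] theorem complexifyConfig_apply (x : Fin n → SpaceTime 3) (k : Fin n) :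
    complexifyConfig x k = complexifyPoint (x k) := rfl

/-- `complexifyPoint` is additive. [folklore] -/
theorem complexifyPoint_sub (a b : SpaceTime 3) : complexifyPoint (a - b) = complexifyPoint a - complexifyPoint b := by
  funext μ; simp [complexifyPoint_apply]

/-- Successive differences commute with complexification. [folklore] -/
theorem succDiff_complexifyConfig (x : Fin n → SpaceTime 3) (k : Fin n) :
    succDiff (complexifyConfig x) k = complexifyPoint (succDiff x k) :=
  succDiff_map complexifyPoint complexifyPoint_sub x k

/-- **Real configurations with all differences in the right wedge lie in the wedge domain**
(Streater–Wightman (1964), Thm. 2-12 in the form adapted to the boosts: such Jost points are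
carried into the tube by `B(iπ/2)`). [cite: StreaterWightman1964, §2-4 Thm 2-12 eq. (2-91)] -/
theorem complexifyConfig_mem_wedgeDomainN {x : Fin n → SpaceTime 3}
    (hx : ∀ k : Fin n, 0 < (k : ℕ) → |succDiff x k 0| < succDiff x k 3) :
    complexifyConfig x ∈ wedgeDomainN := by
  intro k hk
  rw [succDiff_complexifyConfig]
  exact complexifyPoint_mem_wedgeDomain (hx k hk)

/-- `iπ/2` is an admissible rapidity at a point of the wedge domain lying in `𝒯ʳₙ`. [folklore] -/
theorem pi_div_two_mul_I_mem_boostDomainN {z : Fin n → Fin (3 + 1) → ℂ} (hz : z ∈ wedgeDomainN)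
    (hz' : z ∈ QuantumFieldTheory.relForwardTube 3 n) : (π / 2 : ℝ) * I ∈ boostDomainN z :=
  fun k hk => pi_div_two_mul_I_mem_boostDomain (hz k hk) (hz' k hk)

variable (M : ℂ → E →L[ℂ] E) (F : (Fin n → Fin (3 + 1) → ℂ) → E)

/-- The **right wedge extension** `F♯(z) = M(−iπ/2) F(B(iπ/2) z)` of a boost-covariant function on
`𝒯ʳₙ` (Streater–Wightman (1964), §2-4, eq. (2-91) and Thm. 2-11, all variables at once).
[cite: StreaterWightman1964, §2-4 Thm 2-11] -/
def wedgeExtensionN (z : Fin n → Fin (3 + 1) → ℂ) : E := M (-(π / 2 * I)) (F (boostN (π / 2 * I) z))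

/-- The **left wedge extension** `F♭(z) = M(iπ/2) F(B(−iπ/2) z)`. [cite: StreaterWightman1964, §2-4 Thm 2-11] -/
def wedgeExtensionNegN (z : Fin n → Fin (3 + 1) → ℂ) : E := M (π / 2 * I) (F (boostN (-(π / 2 * I)) z))

/-- The **left-wedge domain**: the image of the right-wedge domain under `B(iπ)` (equivalently
`B(−iπ)`): `B(−iπ/2) z ∈ 𝒯ʳₙ` and `Re u < 0 < Re v` for every difference. [folklore] -/
def wedgeDomainNegN : Set (Fin n → Fin (3 + 1) → ℂ) := {z | boostN (π * I) z ∈ wedgeDomainN}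

variable {M F}

/-- **The right wedge extension is holomorphic on the wedge domain.** [folklore] -/
theorem differentiableOn_wedgeExtensionN (hF : DifferentiableOn ℂ F (QuantumFieldTheory.relForwardTube 3 n)) :
    DifferentiableOn ℂ (wedgeExtensionN M F) wedgeDomainN := by
  intro z hz
  have h1 : DifferentiableAt ℂ (fun z => F (boostN (π / 2 * I) z)) z :=
    (hF.differentiableAt (isOpen_relForwardTube.mem_nhds (boostN_mem_relForwardTube_of_mem_wedgeDomainN hz))).comp z
      (differentiable_boostN_right _).differentiableAt
  exact ((M (-(π / 2 * I))).differentiableAt.comp z h1).differentiableWithinAt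

/-- **The right wedge extension agrees with `F` on `𝒯ʳₙ`.** [cite: StreaterWightman1964, §2-4 Thms 2-11, 2-12] -/
theorem wedgeExtensionN_eq_of_mem (hF : DifferentiableOn ℂ F (QuantumFieldTheory.relForwardTube 3 n))
    (hM : Differentiable ℂ M) (hM0 : M 0 = 1) (hMadd : ∀ a b, M (a + b) = M a * M b)
    (hcov : ∀ (χ : ℝ), ∀ z ∈ QuantumFieldTheory.relForwardTube 3 n, F (boostN χ z) = M χ (F z))
    {z : Fin n → Fin (3 + 1) → ℂ} (hz : z ∈ wedgeDomainN) (hz' : z ∈ QuantumFieldTheory.relForwardTube 3 n) :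
    wedgeExtensionN M F z = F z := by
  have hw : ((π / 2 : ℝ) : ℂ) * I = π / 2 * I := by push_cast; ring
  have h := boost_covariance_complexN hF hM hM0 hMadd hcov hz' (pi_div_two_mul_I_mem_boostDomainN hz hz')
  rw [hw] at h
  rw [wedgeExtensionN, h]
  change (M (-(π / 2 * I)) * M (π / 2 * I)) (F z) = F z
  rw [← hMadd, neg_add_cancel, hM0]
  rfl

/-- **Boundary values on the right wedge configurations are the values of the extension**: if
`zₙ → ξ` within `𝒯ʳₙ` and `ξ ∈ wedgeDomainN` then `F(zₙ) → F♯(ξ)`. [cite: StreaterWightman1964, §4-3 proof of Thm 4-7] -/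
theorem tendsto_wedgeExtensionN (hF : DifferentiableOn ℂ F (QuantumFieldTheory.relForwardTube 3 n))
    (hM : Differentiable ℂ M) (hM0 : M 0 = 1) (hMadd : ∀ a b, M (a + b) = M a * M b)
    (hcov : ∀ (χ : ℝ), ∀ z ∈ QuantumFieldTheory.relForwardTube 3 n, F (boostN χ z) = M χ (F z))
    {ξ : Fin n → Fin (3 + 1) → ℂ} (hξ : ξ ∈ wedgeDomainN) :
    Tendsto F (𝓝[QuantumFieldTheory.relForwardTube 3 n] ξ) (𝓝 (wedgeExtensionN M F ξ)) := by
  have hcont : ContinuousAt (wedgeExtensionN M F) ξ :=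
    ((differentiableOn_wedgeExtensionN hF).differentiableAt (isOpen_wedgeDomainN.mem_nhds hξ)).continuousAt
  have h1 : Tendsto (wedgeExtensionN M F) (𝓝[QuantumFieldTheory.relForwardTube 3 n] ξ) (𝓝 (wedgeExtensionN M F ξ)) :=
    hcont.tendsto.mono_left nhdsWithin_le_nhds
  refine h1.congr' ?_
  filter_upwards [mem_nhdsWithin_of_mem_nhds (isOpen_wedgeDomainN.mem_nhds hξ), self_mem_nhdsWithin]
    with z h₁ h₂
  exact wedgeExtensionN_eq_of_mem hF hM hM0 hMadd hcov h₁ h₂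

/-! ### The left wedge and the reflection `B(iπ)` -/

/-- `B(iπ) = B(−iπ)` (`e^{iπ} = e^{−iπ}`). [folklore] -/
theorem boost_pi_mul_I_eq_boost_neg (ζ : Fin (3 + 1) → ℂ) : boost (π * I) ζ = boost (-(π * I)) ζ := by
  have h2 : (π * I + π * I : ℂ) = 2 * π * I := by ring
  have h : boost (π * I + π * I) ζ = ζ := by
    refine ext_lc ?_ ?_ (by simp [boost]) (by simp [boost])
    · rw [lcU_boost, h2, Complex.exp_two_pi_mul_I, one_mul]
    · rw [lcV_boost, h2, Complex.exp_neg, Complex.exp_two_pi_mul_I, inv_one, one_mul]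
  calc boost (π * I) ζ = boost (-(π * I)) (boost (π * I + π * I) ζ) := by
        rw [boost_add, boost_neg_boost]
    _ = boost (-(π * I)) ζ := by rw [h]

/-- `B(iπ)` on configurations equals `B(−iπ)`. [folklore] -/
theorem boostN_pi_mul_I_eq_boostN_neg (z : Fin n → Fin (3 + 1) → ℂ) : boostN (π * I) z = boostN (-(π * I)) z := by
  funext k; exact boost_pi_mul_I_eq_boost_neg (z k)

/-- `B(iπ)` is an involution on configurations. [folklore] -/
@[simp] theorem boostN_pi_mul_I_boostN_pi_mul_I (z : Fin n → Fin (3 + 1) → ℂ) :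
    boostN (π * I) (boostN (π * I) z) = z := by
  conv_lhs => rw [boostN_pi_mul_I_eq_boostN_neg]
  exact boostN_neg_boostN _ _

/-- **`B(iπ)` is the real reflection `r : (x⁰, x¹, x², x³) ↦ (−x⁰, x¹, x², −x³)`** on real points
(`e^{±iπ} = −1`: `u ↦ −u`, `v ↦ −v`). [cite: StreaterWightman1964, §4-3 eq. (4-31)] -/
theorem boost_pi_mul_I_apply (ζ : Fin (3 + 1) → ℂ) :
    boost (π * I) ζ = fun μ => if μ = 0 ∨ μ = 3 then -ζ μ else ζ μ := by
  refine ext_lc ?_ ?_ (by simp [boost]) (by simp [boost])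
  · rw [lcU_boost, Complex.exp_pi_mul_I]; simp [lcU]; ring
  · rw [lcV_boost, Complex.exp_neg, Complex.exp_pi_mul_I]; simp [lcV]; ring

/-- The left-wedge domain is open. [folklore] -/
theorem isOpen_wedgeDomainNegN : IsOpen (wedgeDomainNegN (n := n)) :=
  isOpen_wedgeDomainN.preimage (continuous_boostN_right _)

/-- `B(iπ)` maps the right-wedge domain onto the left-wedge domain. [folklore] -/
theorem boostN_pi_mul_I_mem_wedgeDomainNegN_iff (z : Fin n → Fin (3 + 1) → ℂ) :
    boostN (π * I) z ∈ wedgeDomainNegN ↔ z ∈ wedgeDomainN := by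
  simp only [wedgeDomainNegN, mem_setOf_eq, boostN_pi_mul_I_boostN_pi_mul_I]

/-- **Real configurations with all differences in the left wedge lie in the left-wedge domain.**
[cite: StreaterWightman1964, §2-4 Thm 2-12 eq. (2-91)] -/
theorem complexifyConfig_mem_wedgeDomainNegN {x : Fin n → SpaceTime 3}
    (hx : ∀ k : Fin n, 0 < (k : ℕ) → |succDiff x k 0| < -succDiff x k 3) :
    complexifyConfig x ∈ wedgeDomainNegN := by
  -- `B(iπ) x` is the real configuration `r x`, whose differences lie in the right wedge
  set rx : Fin n → SpaceTime 3 := fun k => WithLp.toLp 2 fun μ => if μ = 0 ∨ μ = 3 then -x k μ else x k μ with hrx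
  have hr : boostN (π * I) (complexifyConfig x) = complexifyConfig rx := by
    funext k μ
    simp only [boostN_apply, boost_pi_mul_I_apply, complexifyConfig_apply, complexifyPoint_apply, hrx]
    split_ifs <;> simp
  have hsucc : ∀ k : Fin n, ∀ μ, succDiff rx k μ = if μ = 0 ∨ μ = 3 then -succDiff x k μ else succDiff x k μ := by
    intro k μ
    have e1 : succDiff rx k μ = succDiff (fun j => rx j μ) k :=
      (succDiff_map (fun p : SpaceTime 3 => p μ) (fun a b => by simp) rx k).symm
    have e2 : succDiff x k μ = succDiff (fun j => x j μ) k :=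
      (succDiff_map (fun p : SpaceTime 3 => p μ) (fun a b => by simp) x k).symm
    rw [e1, e2]
    by_cases hμ : μ = 0 ∨ μ = 3
    · rw [if_pos hμ]
      have : (fun j => rx j μ) = fun j => -x j μ := by funext j; simp [hrx, hμ]
      rw [this]
      exact succDiff_map (fun t : ℝ => -t) (fun a b => by ring) _ k
    · rw [if_neg hμ]
      have : (fun j => rx j μ) = fun j => x j μ := by funext j; simp [hrx, hμ]
      rw [this]
  show boostN (π * I) (complexifyConfig x) ∈ wedgeDomainN
  rw [hr]
  refine complexifyConfig_mem_wedgeDomainN fun k hk => ?_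
  have h0 := hsucc k 0
  have h3 := hsucc k 3
  simp only [true_or, or_true, ↓reduceIte] at h0 h3
  rw [h0, h3, abs_neg]
  exact hx k hk

/-- **The left wedge extension is the reflected right wedge extension**:
`F♭(B(iπ) y) = M(iπ) F♯(y)` — the relation "`𝒲(r ξ) = S(B(iπ)) 𝒲(ξ)`" between the values at a
right-wedge Jost point `ξ` and at its reflection `r ξ` in the left wedge (the boost half of the
total inversion `−1 = B(iπ) ∘ R`). Pure group law. [cite: StreaterWightman1964, §4-3 eqs. (4-29)–(4-31)] -/
theorem wedgeExtensionNegN_boostN_pi_mul_I (hMadd : ∀ a b, M (a + b) = M a * M b) (y : Fin n → Fin (3 + 1) → ℂ) :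
    wedgeExtensionNegN M F (boostN (π * I) y) = M (π * I) (wedgeExtensionN M F y) := by
  simp only [wedgeExtensionNegN, wedgeExtensionN]
  rw [← boostN_add, show -(↑π / 2 * I) + ↑π * I = (π / 2 * I : ℂ) by ring]
  change _ = (M (π * I) * M (-(π / 2 * I))) (F (boostN (π / 2 * I) y))
  rw [← hMadd, show (π * I : ℂ) + -(π / 2 * I) = π / 2 * I by ring]

/-- The left wedge extension in terms of the right one: `F♭ = M(iπ) ∘ F♯ ∘ B(iπ)`. [folklore] -/
theorem wedgeExtensionNegN_eq (hMadd : ∀ a b, M (a + b) = M a * M b) (z : Fin n → Fin (3 + 1) → ℂ) :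
    wedgeExtensionNegN M F z = M (π * I) (wedgeExtensionN M F (boostN (π * I) z)) := by
  rw [← wedgeExtensionNegN_boostN_pi_mul_I hMadd, boostN_pi_mul_I_boostN_pi_mul_I]

/-- **The left wedge extension is holomorphic on the left-wedge domain.** [folklore] -/
theorem differentiableOn_wedgeExtensionNegN (hF : DifferentiableOn ℂ F (QuantumFieldTheory.relForwardTube 3 n))
    (hMadd : ∀ a b, M (a + b) = M a * M b) :
    DifferentiableOn ℂ (wedgeExtensionNegN M F) wedgeDomainNegN := by
  have h : wedgeExtensionNegN M F = fun z => M (π * I) (wedgeExtensionN M F (boostN (π * I) z)) :=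
    funext (wedgeExtensionNegN_eq hMadd)
  rw [h]
  intro z hz
  have h1 : DifferentiableAt ℂ (fun z => wedgeExtensionN M F (boostN (π * I) z)) z :=
    ((differentiableOn_wedgeExtensionN hF).differentiableAt (isOpen_wedgeDomainN.mem_nhds hz)).comp z
      (differentiable_boostN_right _).differentiableAt
  exact ((M (π * I)).differentiableAt.comp z h1).differentiableWithinAt

/-- `−iπ/2` is an admissible rapidity at a point of the left-wedge domain lying in `𝒯ʳₙ`. Proof
through the parity `P₃ : ζ³ ↦ −ζ³` difference by difference: it exchanges `u` and `v`, maps the left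
wedge to the right wedge and conjugates `B(w)` to `B(−w)`, so the one-variable lemma
`pi_div_two_mul_I_mem_boostDomain` applies to the reflected differences. [folklore] -/
theorem neg_pi_div_two_mul_I_mem_boostDomainN {z : Fin n → Fin (3 + 1) → ℂ} (hz : z ∈ wedgeDomainNegN)
    (hz' : z ∈ QuantumFieldTheory.relForwardTube 3 n) : -((π / 2 : ℝ) * I) ∈ boostDomainN z := by
  intro k hk
  have hζ' : succDiff z k ∈ upperTube := hz' k hk
  -- the reflected difference lies in the one-point wedge domain
  have hw : succDiff (boostN (π * I) z) k ∈ wedgeDomain := hz k hk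
  rw [succDiff_boostN] at hw
  set ζ := succDiff z k with hζdef
  -- parity: `P₃ ζ` is in the right-wedge domain and in the tube
  have hP : parity3 ζ ∈ wedgeDomain := by
    obtain ⟨h1, h2, h3⟩ := hw
    refine ⟨?_, ?_, ?_⟩
    · rw [boost_parity3, parity3_mem_upperTube_iff]
      have : boost (-(π / 2 * I)) ζ = boost (π / 2 * I) (boost (π * I) ζ) := by
        rw [boost_pi_mul_I_eq_boost_neg, ← boost_add]; congr 1; ring
      rw [this]; exact h1
    · rw [lcU_parity3]
      have : lcV (boost (π * I) ζ) = -lcV ζ := by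
        rw [boost_pi_mul_I_eq_boost_neg, lcV_boost, neg_neg, Complex.exp_pi_mul_I]; ring
      rw [this, neg_re] at h3; linarith
    · rw [lcV_parity3]
      have : lcU (boost (π * I) ζ) = -lcU ζ := by rw [lcU_boost, Complex.exp_pi_mul_I]; ring
      rw [this, neg_re] at h2; linarith
  have hP' : parity3 ζ ∈ upperTube := (parity3_mem_upperTube_iff ζ).2 hζ'
  have hmem := pi_div_two_mul_I_mem_boostDomain hP hP'
  -- transport back: `B(w) P₃ = P₃ B(−w)` and the orbit angle changes sign
  refine ⟨?_, ?_⟩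
  · have h1 := hmem.1
    rw [boost_parity3, parity3_mem_upperTube_iff] at h1
    simpa using h1
  · have h2 := hmem.2
    simp only [orbitAngle, lcU_parity3, lcV_parity3] at h2 ⊢
    rw [← abs_neg]
    convert h2 using 2
    simp; ring

/-- **The left wedge extension agrees with `F` on `𝒯ʳₙ`.** [cite: StreaterWightman1964, §2-4 Thms 2-11, 2-12] -/
theorem wedgeExtensionNegN_eq_of_mem (hF : DifferentiableOn ℂ F (QuantumFieldTheory.relForwardTube 3 n))
    (hM : Differentiable ℂ M) (hM0 : M 0 = 1) (hMadd : ∀ a b, M (a + b) = M a * M b)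
    (hcov : ∀ (χ : ℝ), ∀ z ∈ QuantumFieldTheory.relForwardTube 3 n, F (boostN χ z) = M χ (F z))
    {z : Fin n → Fin (3 + 1) → ℂ} (hz : z ∈ wedgeDomainNegN) (hz' : z ∈ QuantumFieldTheory.relForwardTube 3 n) :
    wedgeExtensionNegN M F z = F z := by
  have hw : -(((π / 2 : ℝ) : ℂ) * I) = -(π / 2 * I) := by push_cast; ring
  have h := boost_covariance_complexN hF hM hM0 hMadd hcov hz' (neg_pi_div_two_mul_I_mem_boostDomainN hz hz')
  rw [hw] at h
  rw [wedgeExtensionNegN, h]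
  change (M (π / 2 * I) * M (-(π / 2 * I))) (F z) = F z
  rw [← hMadd, add_neg_cancel, hM0]
  rfl

/-- **Boundary values on the left wedge configurations are the values of the left extension.**
[cite: StreaterWightman1964, §4-3 proof of Thm 4-7] -/
theorem tendsto_wedgeExtensionNegN (hF : DifferentiableOn ℂ F (QuantumFieldTheory.relForwardTube 3 n))
    (hM : Differentiable ℂ M) (hM0 : M 0 = 1) (hMadd : ∀ a b, M (a + b) = M a * M b)
    (hcov : ∀ (χ : ℝ), ∀ z ∈ QuantumFieldTheory.relForwardTube 3 n, F (boostN χ z) = M χ (F z))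
    {ξ : Fin n → Fin (3 + 1) → ℂ} (hξ : ξ ∈ wedgeDomainNegN) :
    Tendsto F (𝓝[QuantumFieldTheory.relForwardTube 3 n] ξ) (𝓝 (wedgeExtensionNegN M F ξ)) := by
  have hcont : ContinuousAt (wedgeExtensionNegN M F) ξ :=
    ((differentiableOn_wedgeExtensionNegN hF hMadd).differentiableAt (isOpen_wedgeDomainNegN.mem_nhds hξ)).continuousAt
  have h1 : Tendsto (wedgeExtensionNegN M F) (𝓝[QuantumFieldTheory.relForwardTube 3 n] ξ)
      (𝓝 (wedgeExtensionNegN M F ξ)) := hcont.tendsto.mono_left nhdsWithin_le_nhds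
  refine h1.congr' ?_
  filter_upwards [mem_nhdsWithin_of_mem_nhds (isOpen_wedgeDomainNegN.mem_nhds hξ), self_mem_nhdsWithin]
    with z h₁ h₂
  exact wedgeExtensionNegN_eq_of_mem hF hM hM0 hMadd hcov h₁ h₂

/-! ### The rotation by `π` about the third axis on configurations -/

/-- The rotation `R` by `π` about the third axis acting on every variable. [folklore] -/
def rot3N (z : Fin n → Fin (3 + 1) → ℂ) : Fin n → Fin (3 + 1) → ℂ := fun k => rot3 (z k)

/-- `rot3N_apply`: component formula. [folklore] -/
@[simp] theorem rot3N_apply (z : Fin n → Fin (3 + 1) → ℂ) (k : Fin n) : rot3N z k = rot3 (z k) := rfl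

/-- `R` is additive. [folklore] -/
theorem rot3_sub (ζ ζ' : Fin (3 + 1) → ℂ) : rot3 (ζ - ζ') = rot3 ζ - rot3 ζ' := by
  funext μ; simp only [rot3, Pi.sub_apply]; split_ifs <;> ring

/-- `R` commutes with the successive differences. [folklore] -/
theorem succDiff_rot3N (z : Fin n → Fin (3 + 1) → ℂ) (k : Fin n) : succDiff (rot3N z) k = rot3 (succDiff z k) :=
  succDiff_map rot3 rot3_sub z k

/-- `R` commutes with the boosts. [folklore] -/
theorem boostN_rot3N (w : ℂ) (z : Fin n → Fin (3 + 1) → ℂ) : boostN w (rot3N z) = rot3N (boostN w z) := by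
  funext k; simp [boost_rot3]

/-- `R` preserves `𝒯ʳₙ`. [folklore] -/
theorem rot3N_mem_relForwardTube_iff (z : Fin n → Fin (3 + 1) → ℂ) :
    rot3N z ∈ QuantumFieldTheory.relForwardTube 3 n ↔ z ∈ QuantumFieldTheory.relForwardTube 3 n := by
  simp only [mem_relForwardTube_iff_succDiff, succDiff_rot3N, rot3_mem_upperTube_iff]

/-- `R` preserves the right-wedge domain. [folklore] -/
theorem rot3N_mem_wedgeDomainN_iff (z : Fin n → Fin (3 + 1) → ℂ) : rot3N z ∈ wedgeDomainN ↔ z ∈ wedgeDomainN := by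
  simp only [wedgeDomainN, mem_setOf_eq, succDiff_rot3N, rot3_mem_wedgeDomain_iff]

/-- `R` preserves the left-wedge domain. [folklore] -/
theorem rot3N_mem_wedgeDomainNegN_iff (z : Fin n → Fin (3 + 1) → ℂ) :
    rot3N z ∈ wedgeDomainNegN ↔ z ∈ wedgeDomainNegN := by
  simp only [wedgeDomainNegN, mem_setOf_eq, boostN_rot3N, rot3N_mem_wedgeDomainN_iff]

/-- `R` is continuous. [folklore] -/
theorem continuous_rot3N : Continuous (rot3N (n := n)) := by
  refine continuous_pi fun k => continuous_pi fun μ => ?_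
  have h : Continuous fun z : Fin n → Fin (3 + 1) → ℂ => z k μ :=
    (continuous_apply μ).comp (continuous_apply k)
  simp only [rot3N, rot3]
  split_ifs
  · exact h.neg
  · exact h

/-- **Rotation covariance passes to the right wedge extension**: if `F(R z) = M_R F(z)` on `𝒯ʳₙ` and
`M_R` commutes with `M(−iπ/2)`, then `F♯(R z) = M_R F♯(z)` on the wedge domain. [folklore] -/
theorem wedgeExtensionN_rot3N {MR : E →L[ℂ] E}
    (hrot : ∀ z ∈ QuantumFieldTheory.relForwardTube 3 n, F (rot3N z) = MR (F z))
    (hcomm : M (-(π / 2 * I)) * MR = MR * M (-(π / 2 * I))) {z : Fin n → Fin (3 + 1) → ℂ}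
    (hz : z ∈ wedgeDomainN) : wedgeExtensionN M F (rot3N z) = MR (wedgeExtensionN M F z) := by
  simp only [wedgeExtensionN]
  rw [boostN_rot3N, hrot _ (boostN_mem_relForwardTube_of_mem_wedgeDomainN hz)]
  change (M (-(π / 2 * I)) * MR) (F (boostN (π / 2 * I) z)) = _
  rw [hcomm]
  rfl

/-- **Rotation covariance passes to the left wedge extension.** [folklore] -/
theorem wedgeExtensionNegN_rot3N {MR : E →L[ℂ] E} (hMadd : ∀ a b, M (a + b) = M a * M b)
    (hrot : ∀ z ∈ QuantumFieldTheory.relForwardTube 3 n, F (rot3N z) = MR (F z))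
    (hcomm : M (-(π / 2 * I)) * MR = MR * M (-(π / 2 * I)))
    (hcomm' : M (π * I) * MR = MR * M (π * I)) {z : Fin n → Fin (3 + 1) → ℂ}
    (hz : z ∈ wedgeDomainNegN) : wedgeExtensionNegN M F (rot3N z) = MR (wedgeExtensionNegN M F z) := by
  rw [wedgeExtensionNegN_eq hMadd, wedgeExtensionNegN_eq hMadd, boostN_rot3N,
    wedgeExtensionN_rot3N hrot hcomm hz]
  change (M (π * I) * MR) _ = _
  rw [hcomm']
  rfl

end Wedge

end TubeBoost

end Literature.MathematicalPhysics.QuantumLattice
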